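import Summits.HodgeConjecture.HodgeConjecture.Theses.HolomorphicDefect
import Literature.AlgebraicGeometry.HodgeTheory.LefschetzOneOne
import Literature.AlgebraicGeometry.HodgeTheory.ComplexConjugationHolds

/-!
# Route HolomorphicDefect · `FourfoldHodgeClassesConiveauOne` (stmt-HodgeConjecture-3031) — calibration

The support item `FourfoldHodgeClassesConiveauOne` of route `HolomorphicDefect` says: on every smooth
projective fourfold `X/ℂ`, every rational class `c ∈ H⁴(X(ℂ); ℂ)` of Hodge type `(2,2)` lies in
`N¹H⁴ = supportedClasses X 4 1`, i.e. dies on the complex points of the complement of a proper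
Zariski-closed subset.  This file does NOT settle the item; it pins down, machine-checked, exactly
what the item is:

* `fourfoldHodgeClassesConiveauOne_of_hodgeClassesConiveauOne` — it is the instance `n = 4`, `p = 2`
  of the route's crux `HodgeClassesConiveauOne` (stmt-HodgeConjecture-3025);
* `fourfoldHodgeClassesConiveauOne_of_degreeFour` — it follows from the degree-`4` Hodge conjecture
  for fourfolds (`algebraicClasses X 2 = N² ⊆ N¹`, `supportedClasses_mono`), hence from
  `HodgeConjectureFor 4 X` for all fourfolds and from the summit statement
  (`fourfoldHodgeClassesConiveauOne_of_hodgeConjecture`);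
* `degreeFour_of_fourfoldHodgeClassesConiveauOne` — conversely, together with the route's descent
  item `SupportedHodgeClassDescent` (Deligne, Hodge III 8.2.5) and the Hodge conjecture in
  dimension `≤ 3` (tree named fact `hodgeClasses_algebraic_of_dim_le_three`: Lefschetz `(1,1)` + hard
  Lefschetz), it gives back the degree-`4` Hodge conjecture for every smooth projective fourfold —
  the first open case of the Hodge conjecture (Hodge models exist unconditionally by the tree's
  `nonempty_hodgeModel_holds`, so no model hypothesis is needed).

So, modulo two theorems of the literature, the item is EQUIVALENT to the Hodge conjecture for
rational `(2,2)`-classes on smooth projective fourfolds: it is conjecture-grade, not a provable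
support statement, and it is not a hypothesis of the route's deciding theorem `closes`.
-/

noncomputable section

open Literature.AlgebraicGeometry.Motives Literature.AlgebraicGeometry.HodgeTheory

namespace Summit.HodgeConjecture.HodgeConjecture.Theorems

/-- **Crux ⟹ item.** `FourfoldHodgeClassesConiveauOne` is the instance `n = 4`, `p = 2` of the
route's thesis `HodgeClassesConiveauOne` (every rational Hodge class of degree `2p ≥ 2` has coniveau
`≥ 1`). [cite: Deligne2000, §1 and §2 Remark (vi)] -/
theorem fourfoldHodgeClassesConiveauOne_of_hodgeClassesConiveauOne
    (hX : Theses.HolomorphicDefect.HodgeClassesConiveauOne) :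
    Theses.HolomorphicDefect.FourfoldHodgeClassesConiveauOne := by
  unfold Theses.HolomorphicDefect.FourfoldHodgeClassesConiveauOne
  intro X hXsp c hc hpp
  exact hX hXsp 2 c (Nat.le_succ 1) hc hpp

/-- **Degree-`4` Hodge conjecture for fourfolds ⟹ item.** If every rational `(2,2)`-class on every
smooth projective fourfold is algebraic (`∈ algebraicClasses X 2 = N²H⁴`), then it is supported in
codimension `≥ 1`, since the coniveau filtration is decreasing (`N² ⊆ N¹`, `supportedClasses_mono`):
a cycle class is supported on its cycle. [cite: GrothendieckTopology1969, §1]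
[cite: Deligne2000, §2 Remark (vi)] -/
theorem fourfoldHodgeClassesConiveauOne_of_degreeFour
    (h : ∀ ⦃X : SchemeOver ℂ⦄, IsSmoothProjective 4 X →
      ∀ c : complexBetti X (2 * 2), IsRationalClass c → IsOfHodgeType 4 X (2 * 2) 2 2 c →
        c ∈ algebraicClasses X 2) :
    Theses.HolomorphicDefect.FourfoldHodgeClassesConiveauOne := by
  unfold Theses.HolomorphicDefect.FourfoldHodgeClassesConiveauOne
  intro X hXsp c hc hpp
  exact supportedClasses_mono X (2 * 2) (Nat.le_succ 1) (h hXsp c hc hpp)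

/-- **Hodge conjecture for fourfolds ⟹ item**: the degree-`4` part of `HodgeConjectureFor 4 X`
feeds `fourfoldHodgeClassesConiveauOne_of_degreeFour`. [cite: Deligne2000, §1] -/
theorem fourfoldHodgeClassesConiveauOne_of_hodgeConjectureFor_four
    (h : ∀ ⦃X : SchemeOver ℂ⦄, IsSmoothProjective 4 X → HodgeConjectureFor 4 X) :
    Theses.HolomorphicDefect.FourfoldHodgeClassesConiveauOne :=
  fourfoldHodgeClassesConiveauOne_of_degreeFour fun _ hXsp c hc hpp ↦ (h hXsp).2 2 c hc hpp

/-- **Summit ⟹ item**: the Hodge conjecture (all dimensions) gives `FourfoldHodgeClassesConiveauOne`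
(its dimension-`4`, degree-`4` part, pushed from `N²` into `N¹`). [cite: Deligne2000, §1] -/
theorem fourfoldHodgeClassesConiveauOne_of_hodgeConjecture (h : _root_.HodgeConjecture) :
    Theses.HolomorphicDefect.FourfoldHodgeClassesConiveauOne :=
  fourfoldHodgeClassesConiveauOne_of_hodgeConjectureFor_four fun _ hXsp ↦ h hXsp

/-- **Item ⟹ degree-`4` Hodge conjecture for fourfolds**, granted the route's descent item
`SupportedHodgeClassDescent` (a rational `(p,p)`-class supported in codimension `≥ 1` descends to
Hodge classes on a resolution of its support, algebraic by the Hodge conjecture in lower dimension: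
Deligne, Hodge III, Prop. 8.2.5 + semisimplicity of polarisable Hodge structures) and the Hodge
conjecture for smooth projective varieties of dimension `≤ 3` (the tree's named fact
`hodgeClasses_algebraic_of_dim_le_three`: Lefschetz `(1,1)` + hard Lefschetz, Voisin II, proof of
Prop. 10.26).  Hodge models in dimension `< 4` exist by the tree's theorem `nonempty_hodgeModel_holds`.
With `fourfoldHodgeClassesConiveauOne_of_degreeFour` this exhibits the item as equivalent, modulo
these two theorems, to the first open case of the Hodge conjecture.
[cite: Deligne1974HodgeIII, Prop. 8.2.5] [cite: VoisinHodgeII2003, §10.2.3 proof of Prop. 10.26] -/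
theorem degreeFour_of_fourfoldHodgeClassesConiveauOne
    (hD : Theses.HolomorphicDefect.SupportedHodgeClassDescent)
    (h3 : hodgeClasses_algebraic_of_dim_le_three)
    (h4 : Theses.HolomorphicDefect.FourfoldHodgeClassesConiveauOne)
    ⦃X : SchemeOver ℂ⦄ (hXsp : IsSmoothProjective 4 X)
    (c : complexBetti X (2 * 2)) (hc : IsRationalClass c) (hpp : IsOfHodgeType 4 X (2 * 2) 2 2 c) :
    c ∈ algebraicClasses X 2 := by
  -- the Hodge conjecture below dimension `4`: models exist (tree theorem) and classes are algebraic (`h3`)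
  have ih : ∀ ⦃m : ℕ⦄ ⦃Y : SchemeOver ℂ⦄, m < 4 → IsSmoothProjective m Y → HodgeConjectureFor m Y :=
    fun m Y hm hY ↦ ⟨nonempty_hodgeModel_holds hY, fun q a ha hqq ↦ h3 (Nat.le_of_lt_succ hm) hY q a ha hqq⟩
  exact hD hXsp ih 2 c hc hpp (h4 hXsp c hc hpp)

/-- **Item ⟹ the Hodge conjecture in degree `4` for fourfolds, `HodgeConjectureFor`-style corollary**:
under the same two literature inputs, `FourfoldHodgeClassesConiveauOne` yields, for every smooth
projective fourfold, a Hodge model together with algebraicity of all rational `(2,2)`-classes.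
[cite: Deligne2000, §1] [cite: VoisinHodgeII2003, §10.2.3 proof of Prop. 10.26] -/
theorem hodgeModel_and_degreeFour_of_fourfoldHodgeClassesConiveauOne
    (hD : Theses.HolomorphicDefect.SupportedHodgeClassDescent)
    (h3 : hodgeClasses_algebraic_of_dim_le_three)
    (h4 : Theses.HolomorphicDefect.FourfoldHodgeClassesConiveauOne)
    ⦃X : SchemeOver ℂ⦄ (hXsp : IsSmoothProjective 4 X) :
    Nonempty (HodgeModel 4 X) ∧
      ∀ c : complexBetti X (2 * 2), IsRationalClass c → IsOfHodgeType 4 X (2 * 2) 2 2 c →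
        c ∈ algebraicClasses X 2 :=
  ⟨nonempty_hodgeModel_holds hXsp,
    fun c hc hpp ↦ degreeFour_of_fourfoldHodgeClassesConiveauOne hD h3 h4 hXsp c hc hpp⟩

end Summit.HodgeConjecture.HodgeConjecture.Theorems

end
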